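import Literature.AlgebraicGeometry.Frobenioids.ArchimedeanClausesF
import Literature.AlgebraicGeometry.Frobenioids.ArchimedeanFrobenioidStatements
import Literature.AlgebraicGeometry.Frobenioids.FiberProductsFrobenioid
import Literature.AlgebraicGeometry.Frobenioids.ArchimedeanDivisorMaximality
import HarnessLib

/-!
# Frobenioids II, Example 3.3 (ii): `C = C₀ ×_{D₀} D` is a Frobenioid (discharge of `Ex33ii_isFrobenioid`)

Mochizuki, *The geometry of Frobenioids II: poly-Frobenioids*, Kyushu J. Math. **62** (2008)
401–460, §3, Example 3.3 (ii), author's text p. 28: "Now a routine verification reveals that `C`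
satisfies the conditions of [Mzk5], Definition 1.3, hence that `C` is a *Frobenioid*"
[cite: MochizukiFrdII2008, Ex 3.3 (ii) p.28], for a connected, totally epimorphic base category `D`
with a functor `π : D → D₀`.  PROOF-ONLY file (no definition): the absolute case
`ArchFrd.C0.isFrobenioid` (`C₀ → F_{Φ₀}` is a Frobenioid) is transported along the categorical fiber
product `C = C₀ ×_{D₀} D` by found's [FrdI] Prop. 1.6 (ii)
(`PreFrobenioid.isFrobenioid_fiberProduct_of_isPreFrobenioid`); the pre-Frobenioid structure
`C → F_Φ`, `Φ = Φ₀|_D` (abc-iut-L1-t6's named statement `ArchFrd.C.PreFrobenioidStructure π`) is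
discharged first — `Φ₀|_D` is a monoid on `D` because all its pull-back maps are identities (no
hypothesis on `π`).  Discharges abc-iut-L1-t6's `ArchFrd.C.PreFrobenioidStructure π` and
`ArchFrd.Ex33ii_isFrobenioid π` (HARD, deep pool); and, with no hypothesis on `D`, the lighter claims
of Ex. 3.3 (ii) that reduce to `C₀` along the first projection: "a morphism of `C` is co-angular iff
it is naively co-angular" (`Ex33ii_coAngular_iff_holds`), "every object of `C` is metrically trivial"
(`Ex33ii_metricallyTrivial_holds`: a co-angular pre-step `(f, 1, c)` of `C₀` is refined to the
isomorphism `(f, 1, c · λ_B/(|c| λ_A))`), and "every endomorphism is co-angular"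
(`C.isCoAngular_endo`, the co-angular half of `Ex33ii_endo_of_not_isotropic`).
-/

namespace Literature.AlgebraicGeometry.Frobenioids

open CategoryTheory
open scoped Pointwise

noncomputable section

namespace ArchFrd

namespace C0

open Set in
/-- A co-angular pre-step `ψ = (f, 1, c) : A → B` of `C₀` can be refined to an ISOMORPHISM
`(f, 1, c · λ_B/(|c| λ_A)) : A ⥲ B` (same base arrow; its angular part fills `B_B|_f` by co-angularity,
and positive real scalings are available in every `K^×`). [cite: MochizukiFrdII2008, Ex 3.3 (ii) p.28] -/
theorem exists_iso_of_isCoAngularPreStep {A B : C0} (ψ : A ⟶ B)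
    (h : PreFrobenioid.IsCoAngularPreStep toElem ψ) : ∃ χ : A ⟶ B, IsIso χ ∧ Base χ = Base ψ := by
  have hd : degFr ψ = 1 := h.2.1
  haveI : IsIso (Base ψ) := h.2.2
  obtain ⟨A', hA'c, hA't, hA'd, hA'i⟩ := exists_pulledRegion B (Base ψ)
  -- the angular parts: `(c/|c|) · B_A = τ_f(B_B)` (complex case), everything (real case)
  have hdir : unitPart ℂ (scalar ψ) • A.region.dir = A'.dir := by
    rcases D0.isReal_or_isComplex A.base with hA | hA
    · rw [show A.region.dir = univ from isNaivelyIsotropic_of_isRealObj hA, Set.smul_set_univ]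
      exact (hA'i (isNaivelyIsotropic_of_isRealObj (isRealObj_of_hom ψ hA))).symm
    · have hn := isNaivelyCoAngular_of_isCoAngular ψ h.1 hA
      rwa [image_unitPart_homImage, image_unitPart_pullRegion, hd, PNat.one_coe, pow_one, ← hA'd] at hn
  -- the scalar `c' = t · c`, `t = λ_B / (|c| λ_A)`
  let t : PosReal := B.region.tip * (absHom ℂ (scalar ψ) * A.region.tip)⁻¹
  have habs : absHom ℂ (ofPosReal ℂ t * scalar ψ) * A.region.tip = B.region.tip := by
    rw [absHom_ofPosReal_mul, mul_assoc, inv_mul_cancel_right]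
  have hmem : ofPosReal ℂ t * scalar ψ ∈ D0.scalars A.base :=
    mul_mem (ofPosReal_mem_scalars _ _) ψ.scalar_mem
  obtain ⟨χ, hχb, hχd, hχc⟩ := exists_hom A B (Base ψ) 1 hmem hA'c
    (by rw [unitPart_ofPosReal_mul, PNat.one_coe, pow_one, hdir])
    (by
      rw [PNat.one_coe, pow_one, hA't, tip_eq, ← coe_absHom, ← Positive.val_mul, habs])
  haveI : IsIso (Base χ) := by rw [hχb]; infer_instance
  refine ⟨χ, isIso_of χ hχd ?_, hχb⟩
  rw [hχb, ← hA'c, hχc]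
  have h1 := smul_carrier_pow_eq A.region A' (ofPosReal ℂ t * scalar ψ) 0
    (by rw [zero_add, pow_one, unitPart_ofPosReal_mul, hdir]) (by rw [zero_add, pow_one, habs, hA't])
  rwa [zero_add, pow_one] at h1

/-- **Every object of `C₀` is metrically trivial** ([FrdI] Def. 1.2 (iv)).
[cite: MochizukiFrdII2008, Ex 3.3 (ii) p.28] -/
theorem isMetricallyTrivial (A : C0) : PreFrobenioid.IsMetricallyTrivial toElem A := by
  intro B ψ hco hps
  obtain ⟨χ, hχ, -⟩ := exists_iso_of_isCoAngularPreStep ψ ⟨hco, hps⟩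
  exact ⟨(asIso χ).symm⟩

end C0

universe v u

variable {D : Type u} [Category.{v} D] (π : D ⥤ D0)

namespace C

/-- `Φ = Φ₀|_D` is a monoid on `D` ([FrdI] Def. 1.1 (ii)) for ANY `π : D → D₀`: its pull-back maps
are identities. [cite: MochizukiFrdII2008, Ex 3.3 (i) p.28] -/
theorem isMonoidOn_Φ : IsMonoidOn (Φ π) := by
  refine ⟨fun f => ⟨fun x y h => h, fun x y h => ?_⟩, fun f _ => ⟨fun x y h => h, fun y => ⟨y, rfl⟩⟩⟩
  obtain ⟨a, rfl⟩ := Associates.mk_surjective x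
  obtain ⟨b, rfl⟩ := Associates.mk_surjective y
  exact h

/-- **"we obtain a pre-Frobenioid structure `C → F_Φ` on `C`"** (Ex. 3.3 (i)/(ii), for `D`
connected and totally epimorphic) — discharge of `ArchFrd.C.PreFrobenioidStructure`.
[cite: MochizukiFrdII2008, Ex 3.3 (ii) p.28] -/
theorem preFrobenioidStructure_holds : PreFrobenioidStructure π := fun hDc hDe =>
  { isMonoidOn := isMonoidOn_Φ π
    isDivisorial := objectwise_restrictMonoid isDivisorial_Φ₀
    isGraphConnected_base := hDc
    isTotallyEpimorphic_base := hDe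
    isGraphConnected := PreFrobenioid.isGraphConnected_fiberProduct C0.isFrobenioid hDc
    isTotallyEpimorphic :=
      PreFrobenioid.isTotallyEpimorphic_fiberProduct C0.isTotallyEpimorphic hDe }

end C

/-- **[FrdII] Example 3.3 (ii): `C = C₀ ×_{D₀} D` is a Frobenioid** ("a routine verification reveals
that `C` satisfies the conditions of [Mzk5], Definition 1.3") — discharge of abc-iut-L1-t6's named
statement `ArchFrd.Ex33ii_isFrobenioid`. [cite: MochizukiFrdII2008, Ex 3.3 (ii) p.28] -/
theorem Ex33ii_isFrobenioid_holds : Ex33ii_isFrobenioid π := fun hDc hDe =>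
  PreFrobenioid.isFrobenioid_fiberProduct_of_isPreFrobenioid C0.isFrobenioid
    (C.preFrobenioidStructure_holds π hDc hDe)

/-! ### The claims of Ex. 3.3 (ii) that reduce to `C₀` along the first projection -/

namespace C

/-- **Every endomorphism of `C` is co-angular** (the co-angular half of "every endomorphism of a
non-isotropic object of `C` is linear and co-angular", p. 28; no hypothesis on `D`): [FrdI]
Def. 1.3 (iii)(b) for `C₀` at the identity, transported along the first projection.
[cite: MochizukiFrdII2008, Ex 3.3 (ii) p.28] -/
theorem isCoAngular_endo (X : C π) (φ : X ⟶ X) : PreFrobenioid.IsCoAngular (C.toElem π) φ :=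
  PreFrobenioid.isCoAngular_fiberProduct_of_fst φ
    (PreFrobenioid.isCoAngular_endo C0.toElem C0.isFrobenioid φ.fst)

end C

/-- **[FrdII] Ex. 3.3 (ii): "a morphism of `C` is co-angular if and only if it is naively
co-angular"** — discharge of abc-iut-L1-t6's `ArchFrd.Ex33ii_coAngular_iff` ([FrdI] Prop. 1.6 (iii)
for co-angularity along `C → C₀`, then the `C₀` statement). [cite: MochizukiFrdII2008, Ex 3.3 (ii) p.28] -/
theorem Ex33ii_coAngular_iff_holds : Ex33ii_coAngular_iff π := fun _ _ φ =>
  (PreFrobenioid.isCoAngular_fiberProduct_iff C0.isFrobenioid φ).trans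
    (C0.isCoAngular_iff_isNaivelyCoAngular φ.fst)

/-- **[FrdII] Ex. 3.3 (ii): "every object of `C` is metrically trivial"** (no hypothesis on `D`) —
discharge of abc-iut-L1-t6's `ArchFrd.Ex33ii_metricallyTrivial`: the `C₀`-component of a co-angular
pre-step of `C` is refined to an isomorphism (`C0.exists_iso_of_isCoAngularPreStep`) and lifted back
with the same `D`-component.  (The underlying `IsMetricallyTrivial` statement for a single object is
also abc-iut-L1-t9's `ArchFrd.isMetricallyTrivial_C`, proved there through Thm. 3.6 (iii).)
[cite: MochizukiFrdII2008, Ex 3.3 (ii) p.28] -/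
theorem Ex33ii_metricallyTrivial_holds : Ex33ii_metricallyTrivial π := by
  intro X Y ψ hco hps
  haveI : IsIso ψ.snd := hps.2
  have hco₀ : PreFrobenioid.IsCoAngular C0.toElem ψ.fst :=
    PreFrobenioid.isCoAngular_fst_of_fiberProduct C0.isFrobenioid ψ hco
  have hps₀ : PreFrobenioid.IsPreStep C0.toElem ψ.fst :=
    (PreFrobenioid.isPreStep_fiberProduct_iff ψ hps.2).1 hps
  obtain ⟨χ₀, hχ₀, hb⟩ := C0.exists_iso_of_isCoAngularPreStep ψ.fst ⟨hco₀, hps₀⟩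
  let χ : X ⟶ Y := ⟨χ₀, ψ.snd, by rw [show (PreFrobenioid.baseFunctor C0.toElem).map χ₀ =
    (PreFrobenioid.baseFunctor C0.toElem).map ψ.fst from hb]; exact ψ.w⟩
  haveI : IsIso χ.fst := hχ₀
  haveI : IsIso χ.snd := hps.2
  haveI := CFP.isIso_of_isIso_fst_snd χ
  exact ⟨(asIso χ).symm⟩

end ArchFrd

end

end Literature.AlgebraicGeometry.Frobenioids
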